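import Summits.MatrixMultiplication.MatrixMultiplication.Theses.SnSubsetDichotomy
import Summits.MatrixMultiplication.MatrixMultiplication.Theses.SnThresholdCensus
import Literature.Barriers.MatrixMultiplication.YoungSubgroupBarrierProofs
import Literature.Computability.AlgebraicComplexity.CohnUmansTriangle

/-!
# Disproof of `PolynomialSlack` (stmt-MatrixMultiplication-8306) — standing adversary file (v4, sorry-free)

Crux (route `SnSubsetDichotomy`, rank 5):
`PolynomialSlack := ∀ C : ℝ, ∃ n₀, ∀ n ≥ n₀, ∀ S T U : Finset (Perm (Fin n)), TPP S T U →
  (|S||T||U| : ℝ) * n ^ C ≤ (n!) ^ (3/2)`.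

## Findings (cycle 1, refuter-cdisprove-stmt-MatrixMultiplication-8306-0, 2026-08-15)

* §1 WHY IT RESISTS (proved): `¬ PolynomialSlack → ThresholdSubsetTriples` — a disproof of this crux PROVES the
  route's rank-0 TARGET, hence `ω(ℂ) = 2` through the route's proved deciding theorem `closes`
  (`matrixMultiplication_of_not_polynomialSlack`).  No cheap kill exists: every counterexample family is an
  `ω = 2` construction in `S_n`.
* §2 LOAD-BEARING (proved, UNCONDITIONAL since v3): dropping the TPP makes the bound false at `C = 0`
  (`S = T = U = S_n`); weakening the TPP to its three PAIRWISE specialisations makes it false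
  (`polynomialSlack_false_without_triple'`): §2b formalises the rooted matching stabilisers
  `C(μ_1) ∩ Stab 0`, `C(μ_3) ∩ Stab 1`, `C(μ_5) ∩ Stab 2` in `S_{2m}`, `m` odd — pairwise trivial at slack `n³` —
  and thereby PROVES the sibling support item `SnThresholdCensus.PairwiseTrivialAtThreshold` (stmt-5541;
  candidate proof attached there).  So any proof must use the genuinely three-fold part of the TPP.
* §3 TRUE REGIMES (proved): the bound holds for every `C ≤ 0` from `n₀ = 1` (packing, with the cyclic
  rotation of the TPP), and for every `C` on triples of YOUNG subgroups (tree theorem `BCCGU2017_thm42_holds`,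
  loss `e^{n/5 - O(√n log n)}`).  In print (tree FACT `BCGPU2023_thm32` + `n(S_n) = n - 1`, not in tree) it holds
  for every `C < 1/2`; every `C ≥ 1/2` is open.
* §4 STRENGTHENINGS REFUTED (proved): the uniform-in-`C` version (`∃ n₀ ∀ C`) is false and so is the bound at any
  fixed `n ≥ 2` for large `C` (witness `{1}, {1}, S_n`, volume `n!`); the packing volume `n!` is attained at every `n`.
* §5 COMPUTATION: (C1, done locally) the rooted hyperoctahedral triple `(K_1,K_3,K_5)` is pairwise trivial but its
  number of triple-product violations is RANDOM-LIKE, `N_bad(n) ≈ |K|³/(n-1)!` (3, 19, 147, 1347, ≈15300 at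
  n = 6, 8, 10, 12, 14; ratios 0.70 → 0.97): no triple-level repulsion on the knife edge, so poly-slack sub-triples of
  these hosts are implausible; (C2, kit job j004877, SAT-certified) the largest TPP sub-triples of the rooted hosts
  lose `n^{2.41}` (n = 6, optimal) and `n^{3.07}` (n = 8, sym-optimal) and are (near-)subgroup configurations; inside the
  full centralisers at n = 6 the optimum `12³ = 1728` is the Cohn–Umans triangle volume (three cosets of order-12 groups).
  Follow-ups j014109 (K, n = 10), j014200 (B, n = 8) and the `S_3/S_4` ground truth j005660 are queued (cycle 2).
* §6 (PROVED in v4, file now sorry-free): the exponential-saving strengthening `|S||T||U| ≤ (n!)^{3/2-δ}` is FALSE —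
  the Cohn–Umans 2003 triangle construction is formalised (abstract lex-induction TPP lemma, staircase type,
  transport to `Fin n`, volume `(∏_{k≤N} k!)³ > (n!)^{3/2-δ}` for large `N` by convexity of `x log x` + Stirling).
  The crux's exponent `3/2` is therefore sharp; only subpolynomial-in-`n!` savings are in question.
-/

namespace Summit.MatrixMultiplication.MatrixMultiplication.Cruxes.PolynomialSlack.Disproof

set_option linter.dupNamespace false

open Summit.MatrixMultiplication.MatrixMultiplication.Theses.SnSubsetDichotomy
open Literature.Combinatorics.Additive

/-! ## §0 The crux with its parameters exposed -/

/-- The slack bound at exponent `C` from `n₀` on: the matrix of `PolynomialSlack`. [folklore] -/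
def SlackBound (C : ℝ) (n₀ : ℕ) : Prop :=
  ∀ n ≥ n₀, ∀ S T U : Finset (Equiv.Perm (Fin n)), TripleProductProperty S T U →
    ((S.card * T.card * U.card : ℕ) : ℝ) * (n : ℝ) ^ C ≤ (n.factorial : ℝ) ^ ((3 : ℝ) / 2)

/-- `PolynomialSlack` is literally `∀ C, ∃ n₀, SlackBound C n₀`. [folklore] -/
theorem polynomialSlack_iff : PolynomialSlack ↔ ∀ C : ℝ, ∃ n₀ : ℕ, SlackBound C n₀ := Iff.rfl

/-! ## Analytic helper: polynomials are eventually below `exp (c √n)` -/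

/-- For `c > 0` and any real `C`: `n ^ C ≤ exp (c √n)` for all large `n`
(from `log x ≤ 4 x^{1/4}`, i.e. `Real.log_le_rpow_div`, once `n^{1/4} ≥ 4C⁺/c`). [folklore] -/
theorem exists_rpow_le_exp_sqrt (C c : ℝ) (hc : 0 < c) :
    ∃ N : ℕ, ∀ n : ℕ, N ≤ n → (n : ℝ) ^ C ≤ Real.exp (c * Real.sqrt n) := by
  obtain ⟨N, hN⟩ := exists_nat_ge ((4 * max C 0 / c) ^ (4 : ℝ))
  refine ⟨max N 1, fun n hn => ?_⟩
  have hn1 : (1 : ℝ) ≤ n := by exact_mod_cast (le_max_right N 1).trans hn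
  have hn0 : (0 : ℝ) < n := by linarith
  have hNn : (4 * max C 0 / c) ^ (4 : ℝ) ≤ (n : ℝ) := hN.trans (by exact_mod_cast (le_max_left N 1).trans hn)
  set C' : ℝ := max C 0 with hC'
  have hC'0 : 0 ≤ C' := le_max_right _ _
  have hq0 : 0 ≤ 4 * C' / c := by positivity
  -- t := n^{1/4} ≥ 4C'/c
  set t : ℝ := (n : ℝ) ^ ((4 : ℝ)⁻¹) with ht
  have ht0 : 0 ≤ t := Real.rpow_nonneg hn0.le _
  have htq : 4 * C' / c ≤ t := by
    have h1 : ((4 * C' / c) ^ (4 : ℝ)) ^ ((4 : ℝ)⁻¹) ≤ (n : ℝ) ^ ((4 : ℝ)⁻¹) :=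
      Real.rpow_le_rpow (by positivity) hNn (by norm_num)
    rwa [Real.rpow_rpow_inv hq0 (by norm_num : (4 : ℝ) ≠ 0)] at h1
  -- log n ≤ 4 t
  have hlog : Real.log n ≤ 4 * t := by
    have h := Real.log_le_rpow_div hn0.le (by norm_num : (0 : ℝ) < 4⁻¹)
    rw [div_inv_eq_mul] at h
    linarith
  -- sqrt n = t * t
  have hsq : Real.sqrt n = t * t := by
    rw [Real.sqrt_eq_rpow, ht, ← Real.rpow_add hn0]; norm_num
  -- compare logarithms
  have hmono : (n : ℝ) ^ C ≤ (n : ℝ) ^ C' := Real.rpow_le_rpow_of_exponent_le hn1 (le_max_left _ _)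
  refine hmono.trans ?_
  rw [← Real.log_le_iff_le_exp (Real.rpow_pos_of_pos hn0 _), Real.log_rpow hn0, hsq]
  have h2 : C' * Real.log n ≤ C' * (4 * t) := mul_le_mul_of_nonneg_left hlog hC'0
  have h3 : 4 * C' ≤ c * t := by
    have := mul_le_mul_of_nonneg_left htq hc.le
    rwa [mul_div_cancel₀ _ hc.ne'] at this
  nlinarith [mul_le_mul_of_nonneg_right h3 ht0]

/-! ## §1 Why it resists: a disproof proves the target and `ω(ℂ) = 2` -/

/-- **A refutation of `PolynomialSlack` PROVES the route target `ThresholdSubsetTriples`.**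
`¬ PolynomialSlack` gives one `C` and, for every `n₀`, a TPP triple at some `n ≥ n₀` with
`|S||T||U| > (n!)^{3/2} / n^C`; since `n^C ≤ e^{c√n}` eventually, this beats every threshold `e^{-c√n}`. [folklore] -/
theorem thresholdSubsetTriples_of_not_polynomialSlack (h : ¬ PolynomialSlack) :
    ThresholdSubsetTriples := by
  simp only [PolynomialSlack, not_forall, not_exists, not_le] at h
  obtain ⟨C, hC⟩ := h
  intro c hc n₀
  obtain ⟨N, hN⟩ := exists_rpow_le_exp_sqrt C c hc
  obtain ⟨n, hn, S, T, U, hTPP, hlt⟩ := hC (max n₀ N)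
  refine ⟨n, (le_max_left _ _).trans hn, S, T, U, hTPP, ?_⟩
  have hNn : N ≤ n := (le_max_right _ _).trans hn
  have hpoly := hN n hNn
  set P : ℝ := ((S.card * T.card * U.card : ℕ) : ℝ) with hP
  have hP0 : 0 ≤ P := by positivity
  have hE : 0 < Real.exp (c * Real.sqrt n) := Real.exp_pos _
  -- (n!)^{3/2} < P * n^C ≤ P * exp(c√n)
  have h1 : (n.factorial : ℝ) ^ ((3 : ℝ) / 2) < P * Real.exp (c * Real.sqrt n) :=
    hlt.trans_le (mul_le_mul_of_nonneg_left hpoly hP0)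
  rw [Real.exp_neg]
  calc (n.factorial : ℝ) ^ ((3 : ℝ) / 2) * (Real.exp (c * Real.sqrt n))⁻¹
      < P * Real.exp (c * Real.sqrt n) * (Real.exp (c * Real.sqrt n))⁻¹ :=
        mul_lt_mul_of_pos_right h1 (inv_pos.2 hE)
    _ = P := by rw [mul_inv_cancel_right₀ hE.ne']

/-- **Hence a refutation of `PolynomialSlack` is an `ω(ℂ) = 2` proof** (modulo the provable-now support
`VershikKerovBound`), by the route's proved deciding theorem `closes`. This is WHY the crux resists cheap
disproof: every counterexample family is a polynomial-slack TPP design in `S_n`, i.e. exponent two. [folklore] -/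
theorem matrixMultiplication_of_not_polynomialSlack (h : ¬ PolynomialSlack) (hVK : VershikKerovBound) :
    MatrixMultiplication :=
  closes (thresholdSubsetTriples_of_not_polynomialSlack h) hVK

/-- Contrapositive bookkeeping: the negative side `NoThresholdSubsetTriple` (= ¬ target) implies the crux. [folklore] -/
theorem polynomialSlack_of_noThresholdSubsetTriple (h : NoThresholdSubsetTriple) : PolynomialSlack := by
  by_contra hPS
  obtain ⟨c, hc, n₀, hn₀⟩ := h
  obtain ⟨n, hn, S, T, U, hTPP, hlt⟩ := thresholdSubsetTriples_of_not_polynomialSlack hPS c hc n₀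
  exact absurd (hn₀ n hn S T U hTPP) (not_le.2 hlt)

/-! ## §2 Load-bearing hypotheses -/

/-- The crux with the TPP hypothesis DROPPED. [folklore] -/
def PolynomialSlackWithoutTPP : Prop :=
  ∀ C : ℝ, ∃ n₀ : ℕ, ∀ n ≥ n₀, ∀ S T U : Finset (Equiv.Perm (Fin n)),
    ((S.card * T.card * U.card : ℕ) : ℝ) * (n : ℝ) ^ C ≤ (n.factorial : ℝ) ^ ((3 : ℝ) / 2)

/-- `|S_n| = n!` as a `Finset.card`. [folklore] -/
theorem card_univ_perm (n : ℕ) : (Finset.univ : Finset (Equiv.Perm (Fin n))).card = n.factorial := by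
  rw [Finset.card_univ, Fintype.card_perm, Fintype.card_fin]

/-- **Any proof must use the TPP**: without it, `S = T = U = S_n` has volume `(n!)³ > (n!)^{3/2}` already at
`C = 0`, for every `n ≥ 2`. [folklore] -/
theorem polynomialSlack_false_without_TPP : ¬ PolynomialSlackWithoutTPP := by
  intro h
  obtain ⟨n₀, hn₀⟩ := h 0
  set n := max n₀ 2 with hn
  have h2 : 2 ≤ n := le_max_right _ _
  have key := hn₀ n (le_max_left _ _) Finset.univ Finset.univ Finset.univ
  rw [Real.rpow_zero, mul_one, card_univ_perm] at key
  have hf2 : (2 : ℝ) ≤ n.factorial := by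
    exact_mod_cast (Nat.factorial_le h2).trans' (by decide : 2 ≤ Nat.factorial 2)
  have hf1 : (1 : ℝ) < n.factorial := by linarith
  -- (n!)^{3/2} < (n!)^3 = n! * n! * n!
  have hlt : (n.factorial : ℝ) ^ ((3 : ℝ) / 2) < (n.factorial : ℝ) ^ (3 : ℝ) :=
    Real.rpow_lt_rpow_of_exponent_lt hf1 (by norm_num)
  have h3 : (n.factorial : ℝ) ^ (3 : ℝ) = ((n.factorial * n.factorial * n.factorial : ℕ) : ℝ) := by
    rw [show (3 : ℝ) = ((3 : ℕ) : ℝ) by norm_num, Real.rpow_natCast]; push_cast; ring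
  rw [h3] at hlt
  exact absurd key (not_le.2 hlt)

/-- The three PAIRWISE specialisations of the TPP (`u = u'`, `s = s'`, `t = t'`): the double product
properties of `(S,T)`, `(T,U)`, `(S,U)`, i.e. `Q(S) ∩ Q(T) = Q(T) ∩ Q(U) = Q(S) ∩ Q(U) = {1}`. For three
subgroups this is exactly pairwise trivial intersection. [folklore] -/
def PairwiseProductProperty {G : Type*} [Group G] (S T U : Finset G) : Prop :=
  (∀ s ∈ S, ∀ s' ∈ S, ∀ t ∈ T, ∀ t' ∈ T, s * s'⁻¹ * (t * t'⁻¹) = 1 → s = s' ∧ t = t') ∧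
  (∀ t ∈ T, ∀ t' ∈ T, ∀ u ∈ U, ∀ u' ∈ U, t * t'⁻¹ * (u * u'⁻¹) = 1 → t = t' ∧ u = u') ∧
  (∀ s ∈ S, ∀ s' ∈ S, ∀ u ∈ U, ∀ u' ∈ U, s * s'⁻¹ * (u * u'⁻¹) = 1 → s = s' ∧ u = u')

/-- The TPP of three non-empty sets implies the pairwise product property (specialise the third pair to
`x = x'`). So `PolynomialSlackWithoutTriple` below really is a weakening of the crux's hypothesis on every
triple that matters (an empty set has volume `0`). [folklore] -/
theorem pairwiseProductProperty_of_tpp {G : Type*} [Group G] {S T U : Finset G}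
    (h : TripleProductProperty S T U) (hS : S.Nonempty) (hT : T.Nonempty) (hU : U.Nonempty) :
    PairwiseProductProperty S T U := by
  obtain ⟨s₀, hs₀⟩ := hS; obtain ⟨t₀, ht₀⟩ := hT; obtain ⟨u₀, hu₀⟩ := hU
  refine ⟨fun s hs s' hs' t ht t' ht' he => ?_, fun t ht t' ht' u hu u' hu' he => ?_,
    fun s hs s' hs' u hu u' hu' he => ?_⟩
  · have := h s hs s' hs' t ht t' ht' u₀ hu₀ u₀ hu₀ (by rw [he, mul_inv_cancel, mul_one])
    exact ⟨this.1, this.2.1⟩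
  · have := h s₀ hs₀ s₀ hs₀ t ht t' ht' u hu u' hu' (by rw [mul_inv_cancel, one_mul, he])
    exact ⟨this.2.1, this.2.2⟩
  · have := h s hs s' hs' t₀ ht₀ t₀ ht₀ u hu u' hu' (by rw [mul_inv_cancel, mul_one, he])
    exact ⟨this.1, this.2.2⟩

/-- The crux with the TPP WEAKENED to the pairwise product property. [folklore] -/
def PolynomialSlackWithoutTriple : Prop :=
  ∀ C : ℝ, ∃ n₀ : ℕ, ∀ n ≥ n₀, ∀ S T U : Finset (Equiv.Perm (Fin n)), PairwiseProductProperty S T U →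
    ((S.card * T.card * U.card : ℕ) : ℝ) * (n : ℝ) ^ C ≤ (n.factorial : ℝ) ^ ((3 : ℝ) / 2)

/-- Subgroups with pairwise trivial intersections, viewed as finsets, have the pairwise product property. [folklore] -/
theorem pairwiseProductProperty_of_inf_eq_bot {G : Type*} [Group G] [Fintype G] [DecidableEq G]
    (H₁ H₂ H₃ : Subgroup G) [DecidablePred (· ∈ H₁)] [DecidablePred (· ∈ H₂)] [DecidablePred (· ∈ H₃)]
    (h12 : H₁ ⊓ H₂ = ⊥) (h23 : H₂ ⊓ H₃ = ⊥) (h13 : H₁ ⊓ H₃ = ⊥) :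
    PairwiseProductProperty (Finset.univ.filter (· ∈ H₁)) (Finset.univ.filter (· ∈ H₂))
      (Finset.univ.filter (· ∈ H₃)) := by
  -- generic two-subgroup statement
  have two : ∀ (A B : Subgroup G) [DecidablePred (· ∈ A)] [DecidablePred (· ∈ B)], A ⊓ B = ⊥ →
      ∀ a ∈ Finset.univ.filter (· ∈ A), ∀ a' ∈ Finset.univ.filter (· ∈ A),
      ∀ b ∈ Finset.univ.filter (· ∈ B), ∀ b' ∈ Finset.univ.filter (· ∈ B),
      a * a'⁻¹ * (b * b'⁻¹) = 1 → a = a' ∧ b = b' := by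
    intro A B _ _ hAB a ha a' ha' b hb b' hb' he
    simp only [Finset.mem_filter, Finset.mem_univ, true_and] at ha ha' hb hb'
    have hq : a * a'⁻¹ = (b * b'⁻¹)⁻¹ := eq_inv_of_mul_eq_one_left he
    have hA : a * a'⁻¹ ∈ A := A.mul_mem ha (A.inv_mem ha')
    have hB : a * a'⁻¹ ∈ B := by rw [hq]; exact B.inv_mem (B.mul_mem hb (B.inv_mem hb'))
    have h1 : a * a'⁻¹ = 1 := by
      have : a * a'⁻¹ ∈ A ⊓ B := Subgroup.mem_inf.2 ⟨hA, hB⟩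
      rwa [hAB, Subgroup.mem_bot] at this
    refine ⟨mul_inv_eq_one.1 h1, ?_⟩
    rw [h1, one_mul] at he
    exact mul_inv_eq_one.1 he
  exact ⟨two H₁ H₂ h12, two H₂ H₃ h23, two H₁ H₃ h13⟩

/-- `Nat.card` of a subgroup is the card of its membership filter. [folklore] -/
theorem natCard_subgroup_eq_card_filter {G : Type*} [Group G] [Fintype G] (H : Subgroup G)
    [DecidablePred (· ∈ H)] : Nat.card H = (Finset.univ.filter (· ∈ H)).card := by
  rw [Nat.card_eq_fintype_card, ← Fintype.card_subtype]

/-- **Any proof must use the three-fold part of the TPP** (conditional on the sibling support item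
`SnThresholdCensus.PairwiseTrivialAtThreshold`, stmt-MatrixMultiplication-5541, verified by hand: pairwise-trivial
SUBGROUP triples of `S_n` reach `(n!)^{3/2}/n^{C₀}` infinitely often — rooted matching stabilisers, `C₀ = 3`):
the pairwise-weakened crux fails at `C = C₀ + 1`. Becomes unconditional the moment 5541 lands. [folklore] -/
theorem polynomialSlack_false_without_triple
    (h5541 : Summit.MatrixMultiplication.MatrixMultiplication.Theses.SnThresholdCensus.PairwiseTrivialAtThreshold) :
    ¬ PolynomialSlackWithoutTriple := by
  classical
  intro hW
  obtain ⟨C₀, hC₀⟩ := h5541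
  obtain ⟨n₀, hn₀⟩ := hW (C₀ + 1)
  obtain ⟨n, hn, H, hH, hvol⟩ := hC₀ (max n₀ 2)
  have hn2 : (2 : ℝ) ≤ n := by exact_mod_cast (le_max_right n₀ 2).trans hn
  have hn0 : (0 : ℝ) < n := by linarith
  -- the three finsets
  have hPP := pairwiseProductProperty_of_inf_eq_bot (H 0) (H 1) (H 2) (hH 0 1 (by decide))
    (hH 1 2 (by decide)) (hH 0 2 (by decide))
  have key := hn₀ n ((le_max_left n₀ 2).trans hn) _ _ _ hPP
  rw [← natCard_subgroup_eq_card_filter, ← natCard_subgroup_eq_card_filter,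
    ← natCard_subgroup_eq_card_filter] at key
  set P : ℝ := ((Nat.card (H 0) * Nat.card (H 1) * Nat.card (H 2) : ℕ) : ℝ) with hP
  have hP0 : 0 ≤ P := by positivity
  have hF : 0 < (n.factorial : ℝ) ^ ((3 : ℝ) / 2) := by positivity
  -- P n^{C₀+1} ≤ (n!)^{3/2} ≤ n^{C₀} P
  have hchain : P * (n : ℝ) ^ (C₀ + 1) ≤ (n : ℝ) ^ C₀ * P := key.trans hvol
  have hPpos : 0 < P := by
    rcases hP0.lt_or_eq with h | h
    · exact h
    · rw [← h, mul_zero] at hvol; exact absurd hvol (not_le.2 hF)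
  rw [Real.rpow_add hn0, Real.rpow_one] at hchain
  have : (n : ℝ) ^ C₀ * P * n ≤ (n : ℝ) ^ C₀ * P * 1 := by nlinarith
  have h1 : (n : ℝ) ≤ 1 := le_of_mul_le_mul_left this (by positivity)
  linarith

/-! ## §2b The pairwise-trivial rooted matching triple (proves the sibling item 5541; makes §2 unconditional)

`H_1 = C(μ_1) ∩ Stab 0`, `H_3 = C(μ_3) ∩ Stab 1 = t H_1 t⁻¹`, `H_5 = C(μ_5) ∩ Stab 2 = t² H_1 t⁻²` in `S_{2m}`,
`m` odd, `μ_a x = a - x` (piecewise on `Fin n`), `t = (+1)`: pairwise trivial, `|H_a| ≥ 2^m m!/(2m)`,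
`((2m)!)^{3/2} ≤ (2m)^3 |H_1||H_3||H_5|`.  (Same text as the candidate proof `Proof5541.lean` attached to
stmt-MatrixMultiplication-5541.) -/

namespace RootedMatching

open Equiv

/-! ### The AP matchings `x ↦ a - x (mod n)` written piecewise (omega-friendly) -/

/-- `x ↦ a - x (mod n)` on `Fin n` for `a < n`, piecewise linear. -/
def revFun {n : ℕ} (a : ℕ) (ha : a < n) (x : Fin n) : Fin n :=
  if h : (x : ℕ) ≤ a then ⟨a - x, by omega⟩ else ⟨a + n - x, by have := x.2; omega⟩

/-- Value of `revFun`. [folklore] -/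
theorem revFun_val {n : ℕ} (a : ℕ) (ha : a < n) (x : Fin n) :
    ((revFun a ha x : Fin n) : ℕ) = if (x : ℕ) ≤ a then a - x else a + n - x := by
  unfold revFun; split_ifs <;> rfl

/-- `x ↦ a - x` is an involution. [folklore] -/
theorem revFun_involutive {n : ℕ} (a : ℕ) (ha : a < n) :
    Function.Involutive (revFun (n := n) a ha) := by
  intro x; apply Fin.ext; simp only [revFun_val]; have := x.2; split_ifs <;> omega

/-- The fixed-point-free involution `μ_a : x ↦ a - x` of `ℤ/n` (as a permutation of `Fin n`). -/
def μ {n : ℕ} (a : ℕ) (ha : a < n) : Perm (Fin n) :=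
  Function.Involutive.toPerm (revFun a ha) (revFun_involutive a ha)

/-- Value of `μ_a x`: `a - x` if `x ≤ a`, else `a + n - x`. [folklore] -/
theorem μ_val {n : ℕ} (a : ℕ) (ha : a < n) (x : Fin n) :
    ((μ a ha x : Fin n) : ℕ) = if (x : ℕ) ≤ a then a - x else a + n - x := revFun_val a ha x

/-- `μ_a² = 1`. [folklore] -/
theorem μ_mul_self {n : ℕ} (a : ℕ) (ha : a < n) : μ a ha * μ a ha = 1 := by
  ext x; simp only [Perm.coe_mul, Function.comp_apply, Perm.coe_one, id_eq]
  rw [show μ a ha (μ a ha x) = x from revFun_involutive a ha x]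

/-- `μ_a` is fixed-point-free when `n` is even and `a` odd (parity). [folklore] -/
theorem μ_ne {n : ℕ} (a : ℕ) (ha : a < n) (hn : n % 2 = 0) (hao : a % 2 = 1) (x : Fin n) :
    μ a ha x ≠ x := by
  intro h
  have hv := congrArg Fin.val h
  rw [μ_val] at hv
  have := x.2
  split_ifs at hv <;> omega

/-! ### Reachability: a permutation fixing `0` and commuting with `μ_1, μ_3` (resp. `μ_1, μ_5`) is trivial [folklore] -/

/-- A permutation of `ℤ/n` (`n` even, `n > 3`) fixing `0` and commuting with `μ_1, μ_3` is the identity: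
its fixed-point set contains `0` and is closed under `μ_1, μ_3`, and `μ_3 ∘ μ_1 = (+2)`. [folklore] -/
theorem eq_one_of_comm_one_three {n : ℕ} (h3 : 3 < n) (hn : n % 2 = 0) (σ : Perm (Fin n))
    (h0 : σ ⟨0, by omega⟩ = ⟨0, by omega⟩)
    (c1 : ∀ x, σ (μ 1 (by omega) x) = μ 1 (by omega) (σ x))
    (c3 : ∀ x, σ (μ 3 h3 x) = μ 3 h3 (σ x)) : σ = 1 := by
  have fix1 : ∀ x, σ x = x → σ (μ 1 (by omega) x) = μ 1 (by omega) x := fun x hx => by rw [c1, hx]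
  have fix3 : ∀ x, σ x = x → σ (μ 3 h3 x) = μ 3 h3 x := fun x hx => by rw [c3, hx]
  -- even points, ascending by the translation μ_3 ∘ μ_1 = (+2)
  have hev : ∀ j : ℕ, ∀ hj : 2 * j < n, σ ⟨2 * j, hj⟩ = ⟨2 * j, hj⟩ := by
    intro j
    induction j with
    | zero => intro hj; exact h0
    | succ j ih =>
      intro hj
      have hj' : 2 * j < n := by omega
      have step : μ 3 h3 (μ 1 (by omega) ⟨2 * j, hj'⟩) = ⟨2 * (j + 1), hj⟩ := by
        apply Fin.ext; simp only [μ_val]; split_ifs <;> simp_all <;> omega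
      rw [← step]; exact fix3 _ (fix1 _ (ih hj'))
  refine Equiv.ext fun x => ?_
  simp only [Perm.coe_one, id_eq]
  obtain ⟨v, hv⟩ := x
  rcases Nat.even_or_odd v with ⟨j, rfl⟩ | ⟨j, rfl⟩
  · have e : (⟨j + j, hv⟩ : Fin n) = ⟨2 * j, by omega⟩ := Fin.ext (by simp; omega)
    rw [e]; exact hev j _
  · rcases Nat.eq_zero_or_pos j with rfl | hj
    · have step : μ 1 (by omega) ⟨0, by omega⟩ = (⟨2 * 0 + 1, hv⟩ : Fin n) := by
        apply Fin.ext; simp [μ_val]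
      rw [← step]; exact fix1 _ h0
    · have hw : n - 2 * j < n := by omega
      have step : μ 1 (by omega) ⟨n - 2 * j, hw⟩ = (⟨2 * j + 1, hv⟩ : Fin n) := by
        apply Fin.ext; simp only [μ_val]; split_ifs <;> simp_all <;> omega
      have e : (⟨n - 2 * j, hw⟩ : Fin n) = ⟨2 * (n / 2 - j), by omega⟩ := Fin.ext (by simp; omega)
      have hfix : σ ⟨n - 2 * j, hw⟩ = ⟨n - 2 * j, hw⟩ := by rw [e]; exact hev _ _
      rw [← step]; exact fix1 _ hfix

/-- A permutation of `ℤ/n` (`n ≡ 2 mod 4`, `n > 5`) fixing `0` and commuting with `μ_1, μ_5` is the identity: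
`μ_5 ∘ μ_1 = (+4)` reaches `4ℕ`, wraps through `n - 2 ↦ 2`, then `4ℕ + 2`, then the odd points by `μ_1`. [folklore] -/
theorem eq_one_of_comm_one_five {n : ℕ} (h5 : 5 < n) (hn : n % 4 = 2) (σ : Perm (Fin n))
    (h0 : σ ⟨0, by omega⟩ = ⟨0, by omega⟩)
    (c1 : ∀ x, σ (μ 1 (by omega) x) = μ 1 (by omega) (σ x))
    (c5 : ∀ x, σ (μ 5 h5 x) = μ 5 h5 (σ x)) : σ = 1 := by
  have fix1 : ∀ x, σ x = x → σ (μ 1 (by omega) x) = μ 1 (by omega) x := fun x hx => by rw [c1, hx]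
  have fix5 : ∀ x, σ x = x → σ (μ 5 h5 x) = μ 5 h5 x := fun x hx => by rw [c5, hx]
  -- translation by 4: μ_5 ∘ μ_1
  have step4 : ∀ v : ℕ, ∀ hv : v + 4 < n, v % 2 = 0 →
      μ 5 h5 (μ 1 (by omega) ⟨v, by omega⟩) = ⟨v + 4, hv⟩ := by
    intro v hv hve
    apply Fin.ext; simp only [μ_val]; split_ifs <;> simp_all <;> omega
  -- multiples of 4
  have hA : ∀ j : ℕ, ∀ hj : 4 * j < n, σ ⟨4 * j, hj⟩ = ⟨4 * j, hj⟩ := by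
    intro j
    induction j with
    | zero => intro hj; exact h0
    | succ j ih =>
      intro hj
      have hj' : 4 * j < n := by omega
      have := step4 (4 * j) (by omega) (by omega)
      rw [show (⟨4 * (j + 1), hj⟩ : Fin n) = ⟨4 * j + 4, by omega⟩ from Fin.ext (by simp; ring), ← this]
      exact fix5 _ (fix1 _ (ih hj'))
  -- the wrap: 2 = μ_5 (μ_1 (n - 2)) and n - 2 = 4 j₀
  have h2 : σ ⟨2, by omega⟩ = ⟨2, by omega⟩ := by
    have hw : n - 2 < n := by omega
    have step : μ 5 h5 (μ 1 (by omega) ⟨n - 2, hw⟩) = ⟨2, by omega⟩ := by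
      apply Fin.ext; simp only [μ_val]; split_ifs <;> simp_all <;> omega
    have e : (⟨n - 2, hw⟩ : Fin n) = ⟨4 * ((n - 2) / 4), by omega⟩ := Fin.ext (by simp; omega)
    have hfix : σ ⟨n - 2, hw⟩ = ⟨n - 2, hw⟩ := by rw [e]; exact hA _ _
    rw [← step]; exact fix5 _ (fix1 _ hfix)
  -- 4 j + 2
  have hB : ∀ j : ℕ, ∀ hj : 4 * j + 2 < n, σ ⟨4 * j + 2, hj⟩ = ⟨4 * j + 2, hj⟩ := by
    intro j
    induction j with
    | zero => intro hj; exact h2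
    | succ j ih =>
      intro hj
      have hj' : 4 * j + 2 < n := by omega
      have := step4 (4 * j + 2) (by omega) (by omega)
      rw [show (⟨4 * (j + 1) + 2, hj⟩ : Fin n) = ⟨4 * j + 2 + 4, by omega⟩ from Fin.ext (by simp; ring),
        ← this]
      exact fix5 _ (fix1 _ (ih hj'))
  have hev : ∀ v : ℕ, ∀ hv : v < n, v % 2 = 0 → σ ⟨v, hv⟩ = ⟨v, hv⟩ := by
    intro v hv hve
    rcases Nat.even_or_odd (v / 2) with ⟨i, hi⟩ | ⟨i, hi⟩
    · have e : (⟨v, hv⟩ : Fin n) = ⟨4 * i, by omega⟩ := Fin.ext (by simp; omega)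
      rw [e]; exact hA _ _
    · have e : (⟨v, hv⟩ : Fin n) = ⟨4 * i + 2, by omega⟩ := Fin.ext (by simp; omega)
      rw [e]; exact hB _ _
  refine Equiv.ext fun x => ?_
  simp only [Perm.coe_one, id_eq]
  obtain ⟨v, hv⟩ := x
  rcases Nat.even_or_odd v with ⟨j, rfl⟩ | ⟨j, rfl⟩
  · exact hev _ hv (by omega)
  · rcases Nat.eq_zero_or_pos j with rfl | hj
    · have step : μ 1 (by omega) ⟨0, by omega⟩ = (⟨2 * 0 + 1, hv⟩ : Fin n) := by
        apply Fin.ext; simp [μ_val]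
      rw [← step]; exact fix1 _ h0
    · have hw : n - 2 * j < n := by omega
      have step : μ 1 (by omega) ⟨n - 2 * j, hw⟩ = (⟨2 * j + 1, hv⟩ : Fin n) := by
        apply Fin.ext; simp only [μ_val]; split_ifs <;> simp_all <;> omega
      have hfix : σ ⟨n - 2 * j, hw⟩ = ⟨n - 2 * j, hw⟩ := hev _ hw (by omega)
      rw [← step]; exact fix1 _ hfix

/-! ### The rotation `x ↦ x + 1` and the conjugation identities `t μ_a t⁻¹ = μ_{a+2}` -/

/-- `x ↦ x + 1 (mod n)`, piecewise. -/
def rotFun {n : ℕ} (hn : 0 < n) (x : Fin n) : Fin n :=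
  if h : (x : ℕ) + 1 < n then ⟨x + 1, h⟩ else ⟨0, hn⟩

/-- `x ↦ x - 1 (mod n)`, piecewise. -/
def rotInv {n : ℕ} (hn : 0 < n) (x : Fin n) : Fin n :=
  if h : (x : ℕ) = 0 then ⟨n - 1, by omega⟩ else ⟨x - 1, by have := x.2; omega⟩

/-- Value of `rotFun`. [folklore] -/
theorem rotFun_val {n : ℕ} (hn : 0 < n) (x : Fin n) :
    ((rotFun hn x : Fin n) : ℕ) = if (x : ℕ) + 1 < n then (x : ℕ) + 1 else 0 := by
  unfold rotFun; split_ifs <;> rfl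

/-- Value of `rotInv`. [folklore] -/
theorem rotInv_val {n : ℕ} (hn : 0 < n) (x : Fin n) :
    ((rotInv hn x : Fin n) : ℕ) = if (x : ℕ) = 0 then n - 1 else (x : ℕ) - 1 := by
  unfold rotInv; split_ifs <;> rfl

/-- Translation by one on `Fin n` as a permutation. -/
def rot {n : ℕ} (hn : 0 < n) : Perm (Fin n) where
  toFun := rotFun hn
  invFun := rotInv hn
  left_inv x := by
    apply Fin.ext; rw [rotInv_val, rotFun_val]; have := x.2
    by_cases h1 : (x : ℕ) + 1 < n
    · rw [if_pos h1, if_neg (by omega)]; omega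
    · rw [if_neg h1, if_pos rfl]; omega
  right_inv x := by
    apply Fin.ext; rw [rotFun_val, rotInv_val]; have := x.2
    by_cases h1 : (x : ℕ) = 0
    · rw [if_pos h1, if_neg (by omega)]; omega
    · rw [if_neg h1, if_pos (by omega)]; omega

/-- Value of `rot`. [folklore] -/
theorem rot_val {n : ℕ} (hn : 0 < n) (x : Fin n) :
    ((rot hn x : Fin n) : ℕ) = if (x : ℕ) + 1 < n then (x : ℕ) + 1 else 0 := rotFun_val hn x

/-- Value of `rot⁻¹`. [folklore] -/
theorem rot_symm_val {n : ℕ} (hn : 0 < n) (x : Fin n) :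
    (((rot hn).symm x : Fin n) : ℕ) = if (x : ℕ) = 0 then n - 1 else (x : ℕ) - 1 := rotInv_val hn x

/-- `rot ⟨v⟩ = ⟨v + 1⟩` below the wrap. [folklore] -/
theorem rot_apply_mk {n : ℕ} (hn : 0 < n) (v : ℕ) (hv : v + 1 < n) :
    rot hn ⟨v, by omega⟩ = ⟨v + 1, hv⟩ := by
  apply Fin.ext; rw [rot_val]; simp [hv]

/-- `t μ_a t⁻¹ = μ_{a+2}`. [folklore] -/
theorem rot_conj_μ {n : ℕ} (a : ℕ) (ha2 : a + 2 < n) :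
    rot (by omega) * μ a (by omega) * (rot (by omega))⁻¹ = μ (n := n) (a + 2) ha2 := by
  refine Equiv.ext fun x => Fin.ext ?_
  have hx := x.2
  rw [Perm.mul_apply, Perm.mul_apply, Perm.inv_def, rot_val, μ_val, μ_val, rot_symm_val]
  split_ifs <;> simp_all <;> omega

/-! ### The three rooted matching stabilisers -/

/-- `C(σ₀) ∩ Stab(p)`. -/
def rooted {n : ℕ} (σ₀ : Perm (Fin n)) (p : Fin n) : Subgroup (Perm (Fin n)) :=
  Subgroup.centralizer {σ₀} ⊓ MulAction.stabilizer (Perm (Fin n)) p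

/-- Membership in `C(σ₀) ∩ Stab p`. [folklore] -/
theorem mem_rooted {n : ℕ} {σ₀ : Perm (Fin n)} {p : Fin n} {τ : Perm (Fin n)} :
    τ ∈ rooted σ₀ p ↔ σ₀ * τ = τ * σ₀ ∧ τ p = p := by
  simp [rooted, Subgroup.mem_inf, Subgroup.mem_centralizer_iff, MulAction.mem_stabilizer_iff]

/-- Conjugation transports rooted stabilisers. [folklore] -/
theorem map_conj_rooted {n : ℕ} (σ₀ t : Perm (Fin n)) (p : Fin n) :
    (rooted σ₀ p).map (MulAut.conj t).toMonoidHom = rooted (t * σ₀ * t⁻¹) (t p) := by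
  ext τ
  rw [Subgroup.mem_map, mem_rooted]
  constructor
  · rintro ⟨y, hy, rfl⟩
    rw [mem_rooted] at hy
    obtain ⟨hc, hp⟩ := hy
    refine ⟨?_, ?_⟩
    · show t * σ₀ * t⁻¹ * (t * y * t⁻¹) = t * y * t⁻¹ * (t * σ₀ * t⁻¹)
      calc t * σ₀ * t⁻¹ * (t * y * t⁻¹) = t * (σ₀ * y) * t⁻¹ := by group
        _ = t * (y * σ₀) * t⁻¹ := by rw [hc]
        _ = t * y * t⁻¹ * (t * σ₀ * t⁻¹) := by group
    · show t (y (t⁻¹ (t p))) = t p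
      rw [show t⁻¹ (t p) = p from t.symm_apply_apply p, hp]
  · rintro ⟨hc, hp⟩
    refine ⟨t⁻¹ * τ * t, ?_, ?_⟩
    · rw [mem_rooted]
      refine ⟨?_, ?_⟩
      · calc σ₀ * (t⁻¹ * τ * t) = t⁻¹ * ((t * σ₀ * t⁻¹) * τ) * t := by group
          _ = t⁻¹ * (τ * (t * σ₀ * t⁻¹)) * t := by rw [hc]
          _ = t⁻¹ * τ * t * σ₀ := by group
      · show t⁻¹ (τ (t p)) = p
        rw [hp]; exact t.symm_apply_apply p
    · show t * (t⁻¹ * τ * t) * t⁻¹ = τ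
      group

/-- Conjugation preserves `Nat.card` of subgroups. [folklore] -/
theorem card_map_conj {n : ℕ} (H : Subgroup (Perm (Fin n))) (t : Perm (Fin n)) :
    Nat.card (H.map (MulAut.conj t).toMonoidHom) = Nat.card H :=
  Subgroup.card_map_of_injective (MulAut.conj t).injective

/-- Conjugation commutes with `⊓`. [folklore] -/
theorem map_inf_conj {n : ℕ} (H K : Subgroup (Perm (Fin n))) (t : Perm (Fin n)) :
    (H ⊓ K).map (MulAut.conj t).toMonoidHom =
      H.map (MulAut.conj t).toMonoidHom ⊓ K.map (MulAut.conj t).toMonoidHom :=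
  Subgroup.map_inf_eq H K _ (MulAut.conj t).injective

/-! ### Orders: `|C(μ_a)| = 2^m · m!` and `|C(μ_a)| ≤ n · |C(μ_a) ∩ Stab p|` [folklore] -/

/-- `μ_a ≠ 1`. [folklore] -/
theorem μ_ne_one {n : ℕ} (a : ℕ) (ha : a < n) (hn : n % 2 = 0) (hao : a % 2 = 1) : μ a ha ≠ 1 := by
  intro h
  have hpos : 0 < n := by omega
  exact μ_ne a ha hn hao ⟨0, hpos⟩ (by rw [h]; rfl)

/-- `orderOf μ_a = 2`. [folklore] -/
theorem orderOf_μ {n : ℕ} (a : ℕ) (ha : a < n) (hn : n % 2 = 0) (hao : a % 2 = 1) :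
    orderOf (μ a ha) = 2 :=
  orderOf_eq_prime (by rw [pow_two]; exact μ_mul_self a ha) (μ_ne_one a ha hn hao)

/-- `μ_a` has full support. [folklore] -/
theorem support_μ {n : ℕ} (a : ℕ) (ha : a < n) (hn : n % 2 = 0) (hao : a % 2 = 1) :
    (μ a ha).support = Finset.univ :=
  Finset.eq_univ_iff_forall.2 fun x => Perm.mem_support.2 (μ_ne a ha hn hao x)

/-- `μ_a` on `Fin (2m)` is a product of `m` disjoint transpositions. [folklore] -/
theorem cycleType_μ {m : ℕ} (a : ℕ) (ha : a < 2 * m) (hao : a % 2 = 1) :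
    (μ a ha).cycleType = Multiset.replicate m 2 := by
  have hn : (2 * m) % 2 = 0 := by omega
  obtain ⟨k, hk⟩ := Perm.cycleType_prime_order (σ := μ a ha) (by rw [orderOf_μ a ha hn hao]; exact Nat.prime_two)
  rw [orderOf_μ a ha hn hao] at hk
  have hsum := (μ a ha).sum_cycleType
  rw [hk, support_μ a ha hn hao, Finset.card_univ, Fintype.card_fin, Multiset.sum_replicate,
    smul_eq_mul] at hsum
  have : k + 1 = m := by omega
  rw [hk, this]

/-- `|C(μ_a)| = 2^m · m!` (the hyperoctahedral group `S_2 ≀ S_m`), from `Equiv.Perm.nat_card_centralizer`. [folklore] -/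
theorem card_centralizer_μ {m : ℕ} (hm : 0 < m) (a : ℕ) (ha : a < 2 * m) (hao : a % 2 = 1) :
    Nat.card (Subgroup.centralizer {μ a ha}) = 2 ^ m * m.factorial := by
  rw [Perm.nat_card_centralizer, cycleType_μ a ha hao, Multiset.sum_replicate, smul_eq_mul,
    Fintype.card_fin, Multiset.prod_replicate]
  have htf : (Multiset.replicate m 2).toFinset = {2} := by
    ext x
    simp only [Multiset.mem_toFinset, Multiset.mem_replicate, Finset.mem_singleton]
    exact ⟨fun h => h.2, fun h => ⟨hm.ne', h⟩⟩
  rw [htf, Finset.prod_singleton, Multiset.count_replicate_self]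
  have : 2 * m - m * 2 = 0 := by omega
  rw [this, Nat.factorial_zero, one_mul]

/-- Orbit–stabiliser: `|C(σ₀)| ≤ n · |C(σ₀) ∩ Stab p|`. [folklore] -/
theorem card_centralizer_le {n : ℕ} (σ₀ : Perm (Fin n)) (p : Fin n) :
    Nat.card (Subgroup.centralizer {σ₀}) ≤ n * Nat.card (rooted σ₀ p) := by
  set C : Subgroup (Perm (Fin n)) := Subgroup.centralizer {σ₀} with hC
  have h1 : Nat.card (MulAction.stabilizer C p) * (MulAction.stabilizer C p).index = Nat.card C :=
    Subgroup.card_mul_index _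
  have h2 : (MulAction.stabilizer C p).index = (MulAction.orbit C p).ncard :=
    MulAction.index_stabilizer C p
  have h3 : (MulAction.orbit C p).ncard ≤ n := by
    calc (MulAction.orbit C p).ncard ≤ Nat.card (Fin n) := Set.ncard_le_card _
      _ = n := by simp
  have h4 : Nat.card (MulAction.stabilizer C p) = Nat.card (rooted σ₀ p) := by
    have hs : MulAction.stabilizer C p = (MulAction.stabilizer (Perm (Fin n)) p).subgroupOf C := by
      ext g; rfl
    rw [hs, ← Subgroup.inf_subgroupOf_left]
    exact Nat.card_congr (Subgroup.subgroupOfEquivOfLe inf_le_left).toEquiv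
  rw [← h4, ← h1, h2, mul_comm]
  exact Nat.mul_le_mul_right _ h3

/-! ### Assembly: the pairwise-trivial rooted triple at polynomial slack [folklore] -/

/-- Elements of `C(σ₀) ∩ Stab p` commute with `σ₀` pointwise. [folklore] -/
theorem comm_of_mem_rooted {n : ℕ} {σ₀ τ : Perm (Fin n)} {p : Fin n} (h : τ ∈ rooted σ₀ p) :
    ∀ x, τ (σ₀ x) = σ₀ (τ x) := by
  rw [mem_rooted] at h
  intro x
  have := DFunLike.congr_fun h.1 x
  simpa [Perm.mul_apply] using this.symm

/-- Elements of `C(σ₀) ∩ Stab p` fix `p`. [folklore] -/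
theorem fix_of_mem_rooted {n : ℕ} {σ₀ τ : Perm (Fin n)} {p : Fin n} (h : τ ∈ rooted σ₀ p) :
    τ p = p := (mem_rooted.1 h).2

/-- `(2m)! ≤ (2^m m!)²` (from `C(2m, m) ≤ 4^m`). [folklore] -/
theorem factorial_two_mul_le (m : ℕ) : (2 * m).factorial ≤ (2 ^ m * m.factorial) ^ 2 := by
  have h := Nat.choose_mul_factorial_mul_factorial (Nat.le_mul_of_pos_left m (by norm_num : 0 < 2))
  rw [show 2 * m - m = m by omega] at h
  have hc : (2 * m).choose m ≤ 4 ^ m := by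
    rw [← Nat.centralBinom_eq_two_mul_choose]; exact Nat.centralBinom_le_four_pow m
  calc (2 * m).factorial = (2 * m).choose m * m.factorial * m.factorial := h.symm
    _ ≤ 4 ^ m * m.factorial * m.factorial := by gcongr
    _ = (2 ^ m * m.factorial) ^ 2 := by
        rw [show (4 : ℕ) = 2 ^ 2 by norm_num, ← pow_mul, mul_comm 2 m, pow_mul]; ring

/-- Pure arithmetic: `c ≤ n h` and `n! ≤ c²` give `(n!)^{3/2} ≤ n^3 · h³`. [folklore] -/
theorem volume_ineq (n h c : ℕ) (hle : c ≤ n * h) (hfac : n.factorial ≤ c ^ 2) :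
    (n.factorial : ℝ) ^ ((3 : ℝ) / 2) ≤ (n : ℝ) ^ (3 : ℝ) * ((h * h * h : ℕ) : ℝ) := by
  have hfacR : (n.factorial : ℝ) ≤ (c : ℝ) ^ (2 : ℕ) := by exact_mod_cast hfac
  have hF0 : (0 : ℝ) ≤ (n.factorial : ℝ) := Nat.cast_nonneg _
  have hc0 : (0 : ℝ) ≤ (c : ℝ) := Nat.cast_nonneg _
  have step1 : (n.factorial : ℝ) ^ ((3 : ℝ) / 2) ≤ ((c : ℝ) ^ (2 : ℕ)) ^ ((3 : ℝ) / 2) :=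
    Real.rpow_le_rpow hF0 hfacR (by norm_num)
  have step2 : ((c : ℝ) ^ (2 : ℕ)) ^ ((3 : ℝ) / 2) = (c : ℝ) ^ (3 : ℕ) := by
    rw [← Real.rpow_natCast (c : ℝ) 2, ← Real.rpow_mul hc0]; norm_num
  have hleR : (c : ℝ) ≤ (n : ℝ) * h := by exact_mod_cast hle
  have step3 : (c : ℝ) ^ (3 : ℕ) ≤ ((n : ℝ) * h) ^ (3 : ℕ) := by gcongr
  have step4 : ((n : ℝ) * h) ^ (3 : ℕ) = (n : ℝ) ^ (3 : ℝ) * ((h * h * h : ℕ) : ℝ) := by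
    rw [show (3 : ℝ) = ((3 : ℕ) : ℝ) by norm_num, Real.rpow_natCast]; push_cast; ring
  calc (n.factorial : ℝ) ^ ((3 : ℝ) / 2) ≤ ((c : ℝ) ^ (2 : ℕ)) ^ ((3 : ℝ) / 2) := step1
    _ = (c : ℝ) ^ (3 : ℕ) := step2
    _ ≤ ((n : ℝ) * h) ^ (3 : ℕ) := step3
    _ = (n : ℝ) ^ (3 : ℝ) * ((h * h * h : ℕ) : ℝ) := step4

section Family

variable {m : ℕ} (hm : m % 2 = 1) (h3 : 3 ≤ m)
include hm h3

/-- `0 < 2m`. [folklore] -/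
theorem fam_hn0 : 0 < 2 * m := by omega
/-- `1 < 2m`. [folklore] -/
theorem fam_h1 : 1 < 2 * m := by omega
/-- `3 < 2m`. [folklore] -/
theorem fam_h3 : 3 < 2 * m := by omega
/-- `5 < 2m`. [folklore] -/
theorem fam_h5 : 5 < 2 * m := by omega

/-- `t (C(μ_1) ∩ Stab 0) t⁻¹ = C(μ_3) ∩ Stab 1`. [folklore] -/
theorem map_H1 : (rooted (μ 1 (fam_h1 hm h3)) ⟨0, fam_hn0 hm h3⟩).map
      (MulAut.conj (rot (fam_hn0 hm h3))).toMonoidHom =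
    rooted (μ 3 (fam_h3 hm h3)) ⟨1, fam_h1 hm h3⟩ := by
  rw [map_conj_rooted, rot_apply_mk (fam_hn0 hm h3) 0 (fam_h1 hm h3), rot_conj_μ 1 (fam_h3 hm h3)]

/-- `t (C(μ_3) ∩ Stab 1) t⁻¹ = C(μ_5) ∩ Stab 2`. [folklore] -/
theorem map_H3 : (rooted (μ 3 (fam_h3 hm h3)) ⟨1, fam_h1 hm h3⟩).map
      (MulAut.conj (rot (fam_hn0 hm h3))).toMonoidHom =
    rooted (μ 5 (fam_h5 hm h3)) ⟨2, by omega⟩ := by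
  rw [map_conj_rooted, rot_apply_mk (fam_hn0 hm h3) 1 (by omega), rot_conj_μ 3 (fam_h5 hm h3)]

/-- `H_1 ⊓ H_3 = ⊥`. [folklore] -/
theorem inf_H1_H3 : rooted (μ 1 (fam_h1 hm h3)) ⟨0, fam_hn0 hm h3⟩ ⊓
    rooted (μ 3 (fam_h3 hm h3)) ⟨1, fam_h1 hm h3⟩ = ⊥ := by
  rw [Subgroup.eq_bot_iff_forall]
  intro σ hσ
  rw [Subgroup.mem_inf] at hσ
  exact eq_one_of_comm_one_three (fam_h3 hm h3) (by omega) σ (fix_of_mem_rooted hσ.1)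
    (comm_of_mem_rooted hσ.1) (comm_of_mem_rooted hσ.2)

/-- `H_1 ⊓ H_5 = ⊥` (uses `m` odd). [folklore] -/
theorem inf_H1_H5 : rooted (μ 1 (fam_h1 hm h3)) ⟨0, fam_hn0 hm h3⟩ ⊓
    rooted (μ 5 (fam_h5 hm h3)) ⟨2, by omega⟩ = ⊥ := by
  rw [Subgroup.eq_bot_iff_forall]
  intro σ hσ
  rw [Subgroup.mem_inf] at hσ
  exact eq_one_of_comm_one_five (fam_h5 hm h3) (by omega) σ (fix_of_mem_rooted hσ.1)
    (comm_of_mem_rooted hσ.1) (comm_of_mem_rooted hσ.2)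

/-- `H_3 ⊓ H_5 = ⊥` (conjugate of `H_1 ⊓ H_3`). [folklore] -/
theorem inf_H3_H5 : rooted (μ 3 (fam_h3 hm h3)) ⟨1, fam_h1 hm h3⟩ ⊓
    rooted (μ 5 (fam_h5 hm h3)) ⟨2, by omega⟩ = ⊥ := by
  rw [← map_H3 hm h3, ← map_H1 hm h3, ← map_inf_conj, map_H1 hm h3, inf_H1_H3 hm h3,
    Subgroup.map_bot]

/-- `|H_3| = |H_1|`. [folklore] -/
theorem card_H3 : Nat.card (rooted (μ 3 (fam_h3 hm h3)) ⟨1, fam_h1 hm h3⟩) =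
    Nat.card (rooted (μ 1 (fam_h1 hm h3)) ⟨0, fam_hn0 hm h3⟩) := by
  rw [← map_H1 hm h3]; exact card_map_conj _ _

/-- `|H_5| = |H_1|`. [folklore] -/
theorem card_H5 : Nat.card (rooted (μ 5 (fam_h5 hm h3)) ⟨2, by omega⟩) =
    Nat.card (rooted (μ 1 (fam_h1 hm h3)) ⟨0, fam_hn0 hm h3⟩) := by
  rw [← map_H3 hm h3, card_map_conj, card_H3 hm h3]

/-- `2^m m! ≤ 2m · |H_1|`. [folklore] -/
theorem card_H1_ge : 2 ^ m * m.factorial ≤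
    2 * m * Nat.card (rooted (μ 1 (fam_h1 hm h3)) ⟨0, fam_hn0 hm h3⟩) := by
  rw [← card_centralizer_μ (by omega) 1 (fam_h1 hm h3) (by norm_num)]
  exact card_centralizer_le _ _

/-- The pairwise-trivial rooted triple in `S_{2m}`, `m` odd, `m ≥ 3`, at polynomial slack `n³`. [folklore] -/
theorem pairwiseTrivial_family :
    ∃ H : Fin 3 → Subgroup (Perm (Fin (2 * m))), (∀ i j, i ≠ j → H i ⊓ H j = ⊥) ∧
      ((2 * m).factorial : ℝ) ^ ((3 : ℝ) / 2) ≤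
        ((2 * m : ℕ) : ℝ) ^ (3 : ℝ) * ((Nat.card (H 0) * Nat.card (H 1) * Nat.card (H 2) : ℕ) : ℝ) := by
  refine ⟨![rooted (μ 1 (fam_h1 hm h3)) ⟨0, fam_hn0 hm h3⟩, rooted (μ 3 (fam_h3 hm h3)) ⟨1, fam_h1 hm h3⟩,
    rooted (μ 5 (fam_h5 hm h3)) ⟨2, by omega⟩], ?_, ?_⟩
  · intro i j hij
    fin_cases i <;> fin_cases j
    · exact absurd rfl hij
    · exact inf_H1_H3 hm h3
    · exact inf_H1_H5 hm h3
    · show rooted _ _ ⊓ rooted _ _ = ⊥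
      rw [inf_comm]; exact inf_H1_H3 hm h3
    · exact absurd rfl hij
    · exact inf_H3_H5 hm h3
    · show rooted _ _ ⊓ rooted _ _ = ⊥
      rw [inf_comm]; exact inf_H1_H5 hm h3
    · show rooted _ _ ⊓ rooted _ _ = ⊥
      rw [inf_comm]; exact inf_H3_H5 hm h3
    · exact absurd rfl hij
  · show ((2 * m).factorial : ℝ) ^ ((3 : ℝ) / 2) ≤ ((2 * m : ℕ) : ℝ) ^ (3 : ℝ) *
      ((Nat.card (rooted (μ 1 (fam_h1 hm h3)) ⟨0, fam_hn0 hm h3⟩) *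
        Nat.card (rooted (μ 3 (fam_h3 hm h3)) ⟨1, fam_h1 hm h3⟩) *
        Nat.card (rooted (μ 5 (fam_h5 hm h3)) ⟨2, by omega⟩) : ℕ) : ℝ)
    rw [card_H3 hm h3, card_H5 hm h3]
    exact volume_ineq (2 * m) _ (2 ^ m * m.factorial) (card_H1_ge hm h3) (factorial_two_mul_le m)

end Family

end RootedMatching

/-- **The sibling support item `SnThresholdCensus.PairwiseTrivialAtThreshold` (stmt-5541) HOLDS**, `C = 3`,
`n = 2(2n₀+3)`. [folklore] -/
theorem pairwiseTrivialAtThreshold_holds :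
    Summit.MatrixMultiplication.MatrixMultiplication.Theses.SnThresholdCensus.PairwiseTrivialAtThreshold := by
  refine ⟨3, fun n₀ => ?_⟩
  obtain ⟨H, hH, hvol⟩ := RootedMatching.pairwiseTrivial_family (m := 2 * n₀ + 3) (by omega) (by omega)
  exact ⟨2 * (2 * n₀ + 3), by omega, H, hH, hvol⟩

/-- **Any proof of `PolynomialSlack` must use the three-fold part of the TPP — unconditionally**: the crux with
the TPP weakened to its three pairwise specialisations is FALSE (rooted matching stabilisers, slack `n³`,
so the weakened bound fails at `C = 4`). [folklore] -/
theorem polynomialSlack_false_without_triple' : ¬ PolynomialSlackWithoutTriple :=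
  polynomialSlack_false_without_triple pairwiseTrivialAtThreshold_holds

/-! ## §3 True regimes: what a counterexample has to beat -/

/-- Cyclic rotation of the TPP: `(S,T,U) ↦ (T,U,S)` (conjugate the relation by `s s'⁻¹`). [folklore] -/
theorem tpp_rotate {G : Type*} [Group G] {S T U : Finset G} (h : TripleProductProperty S T U) :
    TripleProductProperty T U S := by
  intro t ht t' ht' u hu u' hu' s hs s' hs' he
  have key : s * s'⁻¹ * (t * t'⁻¹) * (u * u'⁻¹) =
      (s * s'⁻¹) * (t * t'⁻¹ * (u * u'⁻¹) * (s * s'⁻¹)) * (s * s'⁻¹)⁻¹ := by group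
  rw [he, mul_one, mul_inv_cancel] at key
  obtain ⟨h1, h2, h3⟩ := h s hs s' hs' t ht t' ht' u hu u' hu' key
  exact ⟨h2, h3, h1⟩

/-- Packing bound in `S_n` for a TPP triple with non-empty third set: `|S||T| ≤ n!`. [folklore] -/
theorem card_mul_card_le_factorial {n : ℕ} {S T U : Finset (Equiv.Perm (Fin n))}
    (h : TripleProductProperty S T U) (hU : U.Nonempty) : S.card * T.card ≤ n.factorial := by
  have hr : Literature.Computability.AlgebraicComplexity.RealizesTPP (Equiv.Perm (Fin n)) S.card T.card U.card :=
    ⟨S, T, U, rfl, rfl, rfl, h⟩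
  have := hr.mul_le_card (Finset.card_pos.2 hU).ne'
  rwa [Fintype.card_perm, Fintype.card_fin] at this

/-- **The packing bound `|S||T||U| ≤ (n!)^{3/2}`** for every TPP triple in `S_n` (square root of the product
of the three pairwise packing bounds; an empty set gives volume `0`). This is `PolynomialSlack` at `C = 0`
with `n₀ = 0`. [folklore] -/
theorem volume_le_factorial_rpow {n : ℕ} {S T U : Finset (Equiv.Perm (Fin n))}
    (h : TripleProductProperty S T U) :
    ((S.card * T.card * U.card : ℕ) : ℝ) ≤ (n.factorial : ℝ) ^ ((3 : ℝ) / 2) := by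
  have hF : (0 : ℝ) ≤ (n.factorial : ℝ) ^ ((3 : ℝ) / 2) := by positivity
  rcases S.eq_empty_or_nonempty with hS | hS
  · rw [hS, Finset.card_empty, zero_mul, zero_mul, Nat.cast_zero]; exact hF
  rcases T.eq_empty_or_nonempty with hT | hT
  · rw [hT, Finset.card_empty, mul_zero, zero_mul, Nat.cast_zero]; exact hF
  rcases U.eq_empty_or_nonempty with hU | hU
  · rw [hU, Finset.card_empty, mul_zero, Nat.cast_zero]; exact hF
  have h1 := card_mul_card_le_factorial h hU
  have h2 := card_mul_card_le_factorial (tpp_rotate h) hS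
  have h3 := card_mul_card_le_factorial (tpp_rotate (tpp_rotate h)) hT
  -- (|S||T||U|)² ≤ (n!)³ in ℕ
  have hsq : (S.card * T.card * U.card) ^ 2 ≤ n.factorial ^ 3 := by
    calc (S.card * T.card * U.card) ^ 2
        = (S.card * T.card) * (T.card * U.card) * (U.card * S.card) := by ring
      _ ≤ n.factorial * n.factorial * n.factorial :=
        Nat.mul_le_mul (Nat.mul_le_mul h1 h2) h3
      _ = n.factorial ^ 3 := by ring
  have hsqR : (((S.card * T.card * U.card : ℕ) : ℝ)) ^ (2 : ℕ) ≤ (n.factorial : ℝ) ^ (3 : ℕ) := by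
    exact_mod_cast hsq
  have hF0 : (0 : ℝ) ≤ n.factorial := Nat.cast_nonneg _
  -- take square roots
  have hlhs : (0 : ℝ) ≤ ((S.card * T.card * U.card : ℕ) : ℝ) := Nat.cast_nonneg _
  have key : Real.sqrt ((((S.card * T.card * U.card : ℕ) : ℝ)) ^ (2 : ℕ)) ≤
      Real.sqrt ((n.factorial : ℝ) ^ (3 : ℕ)) := Real.sqrt_le_sqrt hsqR
  rw [Real.sqrt_sq hlhs] at key
  refine key.trans (le_of_eq ?_)
  rw [Real.sqrt_eq_rpow, ← Real.rpow_natCast, ← Real.rpow_mul hF0]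
  norm_num

/-- **`PolynomialSlack` holds for every `C ≤ 0`, from `n₀ = 1`** (packing and `n^C ≤ 1`). [folklore] -/
theorem slackBound_of_nonpos {C : ℝ} (hC : C ≤ 0) : SlackBound C 1 := by
  intro n hn S T U h
  have hn1 : (1 : ℝ) ≤ n := by exact_mod_cast hn
  have hnC : (n : ℝ) ^ C ≤ 1 := Real.rpow_le_one_of_one_le_of_nonpos hn1 hC
  have hP0 : (0 : ℝ) ≤ ((S.card * T.card * U.card : ℕ) : ℝ) := Nat.cast_nonneg _
  calc ((S.card * T.card * U.card : ℕ) : ℝ) * (n : ℝ) ^ C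
      ≤ ((S.card * T.card * U.card : ℕ) : ℝ) * 1 := mul_le_mul_of_nonneg_left hnC hP0
    _ ≤ (n.factorial : ℝ) ^ ((3 : ℝ) / 2) := by rw [mul_one]; exact volume_le_factorial_rpow h

/-- The `C ≤ 0` half of the crux, unconditionally. [folklore] -/
theorem polynomialSlack_nonpos_half : ∀ C : ℝ, C ≤ 0 → ∃ n₀ : ℕ, SlackBound C n₀ :=
  fun _ hC => ⟨1, slackBound_of_nonpos hC⟩

/-- **`PolynomialSlack` holds on YOUNG-subgroup triples, for every `C`** — from the tree THEOREM
`BCCGU2017_thm42_holds` (BCCGU 2017 Thm 4.2 with `c = 1/5`, `d = 3e⁷`): a Young TPP triple has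
`(|H₁||H₂||H₃|)^{2/3} ≤ n! · e^{-(n/5 - 3e⁷ √n log n)}`, and `n^C e^{-(3/2)(n/5 - 3e⁷√n log n)} ≤ 1` eventually.
So every counterexample to the crux must leave the Young class (the barrier `YoungSubgroupBarrier`). [folklore] -/
theorem slackBound_young (C : ℝ) : ∃ n₀ : ℕ, ∀ n ≥ n₀, ∀ f₁ f₂ f₃ : Fin n → ℕ,
    TripleProductProperty (Finset.univ.filter (· ∈ Literature.Barriers.MatrixMultiplication.youngSubgroup f₁))
      (Finset.univ.filter (· ∈ Literature.Barriers.MatrixMultiplication.youngSubgroup f₂))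
      (Finset.univ.filter (· ∈ Literature.Barriers.MatrixMultiplication.youngSubgroup f₃)) →
    (((Finset.univ.filter (· ∈ Literature.Barriers.MatrixMultiplication.youngSubgroup f₁)).card *
        (Finset.univ.filter (· ∈ Literature.Barriers.MatrixMultiplication.youngSubgroup f₂)).card *
        (Finset.univ.filter (· ∈ Literature.Barriers.MatrixMultiplication.youngSubgroup f₃)).card : ℕ) : ℝ) *
      (n : ℝ) ^ C ≤ (n.factorial : ℝ) ^ ((3 : ℝ) / 2) := by
  classical
  obtain ⟨c, d, hc, hd, hthm⟩ := Literature.Barriers.MatrixMultiplication.BCCGU2017_thm42_holds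
  -- threshold: n^{1/4} ≥ (4 d + 4 C⁺) / c  (then c n ≥ 4 d n^{3/4} + 4 C⁺ n^{1/4} ≥ d √n log n + C⁺ log n... )
  obtain ⟨N, hN⟩ := exists_nat_ge (((4 * d + 4 * max C 0) / c) ^ (4 : ℝ))
  refine ⟨max N 2, fun n hn f₁ f₂ f₃ hTPP => ?_⟩
  have hn2 : 2 ≤ n := (le_max_right N 2).trans hn
  have hn2R : (2 : ℝ) ≤ n := by exact_mod_cast hn2
  have hn0 : (0 : ℝ) < n := by linarith
  have hn1 : (1 : ℝ) ≤ n := by linarith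
  obtain ⟨h12, h23, h13⟩ :=
    Literature.Barriers.MatrixMultiplication.inf_eq_bot_of_tripleProductProperty _ _ _ hTPP
  have key := hthm n hn2 f₁ f₂ f₃ h12 h23 h13
  rw [← natCard_subgroup_eq_card_filter, ← natCard_subgroup_eq_card_filter,
    ← natCard_subgroup_eq_card_filter]
  set P : ℝ := ((Nat.card (Literature.Barriers.MatrixMultiplication.youngSubgroup f₁) *
      Nat.card (Literature.Barriers.MatrixMultiplication.youngSubgroup f₂) *
      Nat.card (Literature.Barriers.MatrixMultiplication.youngSubgroup f₃) : ℕ) : ℝ) with hP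
  set F : ℝ := (n.factorial : ℝ) with hF
  set E : ℝ := c * n - d * Real.sqrt n * Real.log n with hE
  have hF0 : 0 < F := by rw [hF]; exact_mod_cast n.factorial_pos
  have hP0 : 0 ≤ P := by positivity
  -- from the barrier: exp E ≤ F / P^{2/3}
  change Real.exp E ≤ F / P ^ (2 / 3 : ℝ) at key
  rcases hP0.lt_or_eq with hPpos | hP00
  swap
  · rw [← hP00, zero_mul]; positivity
  have hP23 : 0 < P ^ (2 / 3 : ℝ) := Real.rpow_pos_of_pos hPpos _
  -- P^{2/3} ≤ F exp(-E)
  have h1 : P ^ (2 / 3 : ℝ) ≤ F * Real.exp (-E) := by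
    rw [Real.exp_neg, ← div_eq_mul_inv, le_div_iff₀ (Real.exp_pos _), mul_comm]
    exact (le_div_iff₀ hP23).1 key
  -- P ≤ (F exp(-E))^{3/2}
  have h2 : P ≤ (F * Real.exp (-E)) ^ ((3 : ℝ) / 2) := by
    have := Real.rpow_le_rpow hP23.le h1 (by norm_num : (0 : ℝ) ≤ 3 / 2)
    rwa [← Real.rpow_mul hP0, show (2 / 3 : ℝ) * (3 / 2) = 1 by norm_num, Real.rpow_one] at this
  rw [Real.mul_rpow hF0.le (Real.exp_pos _).le, ← Real.exp_mul] at h2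
  -- suffices: exp(-E * 3/2) * n^C ≤ 1
  suffices hsuff : Real.exp (-E * ((3 : ℝ) / 2)) * (n : ℝ) ^ C ≤ 1 by
    calc P * (n : ℝ) ^ C ≤ F ^ ((3 : ℝ) / 2) * Real.exp (-E * ((3 : ℝ) / 2)) * (n : ℝ) ^ C :=
          mul_le_mul_of_nonneg_right h2 (Real.rpow_nonneg hn0.le _)
      _ = F ^ ((3 : ℝ) / 2) * (Real.exp (-E * ((3 : ℝ) / 2)) * (n : ℝ) ^ C) := by ring
      _ ≤ F ^ ((3 : ℝ) / 2) * 1 := mul_le_mul_of_nonneg_left hsuff (Real.rpow_nonneg hF0.le _)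
      _ = F ^ ((3 : ℝ) / 2) := mul_one _
  -- i.e. C log n ≤ (3/2) E ; we show C⁺ log n ≤ E and E ≥ 0
  have hmono : (n : ℝ) ^ C ≤ (n : ℝ) ^ (max C 0) := Real.rpow_le_rpow_of_exponent_le hn1 (le_max_left _ _)
  set C' : ℝ := max C 0 with hC'
  have hC'0 : 0 ≤ C' := le_max_right _ _
  -- the quarter-power bookkeeping
  set t : ℝ := (n : ℝ) ^ ((4 : ℝ)⁻¹) with ht
  have ht0 : 0 ≤ t := Real.rpow_nonneg hn0.le _
  have ht1 : 1 ≤ t := Real.one_le_rpow hn1 (by norm_num)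
  have hq0 : 0 ≤ (4 * d + 4 * C') / c := by positivity
  have hNn : ((4 * d + 4 * C') / c) ^ (4 : ℝ) ≤ (n : ℝ) := hN.trans (by exact_mod_cast (le_max_left N 2).trans hn)
  have htq : (4 * d + 4 * C') / c ≤ t := by
    have h1 : (((4 * d + 4 * C') / c) ^ (4 : ℝ)) ^ ((4 : ℝ)⁻¹) ≤ (n : ℝ) ^ ((4 : ℝ)⁻¹) :=
      Real.rpow_le_rpow (by positivity) hNn (by norm_num)
    rwa [Real.rpow_rpow_inv hq0 (by norm_num : (4 : ℝ) ≠ 0)] at h1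
  have hlog : Real.log n ≤ 4 * t := by
    have h := Real.log_le_rpow_div hn0.le (by norm_num : (0 : ℝ) < 4⁻¹)
    rw [div_inv_eq_mul] at h
    linarith
  have hlog0 : 0 ≤ Real.log n := Real.log_nonneg hn1
  have hsq : Real.sqrt n = t * t := by
    rw [Real.sqrt_eq_rpow, ht, ← Real.rpow_add hn0]; norm_num
  have hn4 : (n : ℝ) = t * t * (t * t) := by
    rw [← hsq, Real.mul_self_sqrt hn0.le]
  -- c n ≥ (4d + 4C') t³ ≥ 4 d t² · t + 4 C' t ≥ d √n log n + C' log n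
  have hct : 4 * d + 4 * C' ≤ c * t := by
    have := mul_le_mul_of_nonneg_left htq hc.le
    rwa [mul_div_cancel₀ _ hc.ne'] at this
  have hE_lb : C' * Real.log n ≤ E := by
    have hcn : c * (n : ℝ) = c * t * (t * t * t) := by rw [hn4]; ring
    have httt : 0 ≤ t * t * t := by positivity
    have h3 : (4 * d + 4 * C') * (t * t * t) ≤ c * t * (t * t * t) :=
      mul_le_mul_of_nonneg_right hct httt
    have hdl : d * (t * t) * Real.log n ≤ d * (t * t) * (4 * t) :=
      mul_le_mul_of_nonneg_left hlog (by positivity)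
    have hcl : C' * Real.log n ≤ C' * (4 * t) := mul_le_mul_of_nonneg_left hlog hC'0
    have h1tt : 1 ≤ t * t := one_le_mul_of_one_le_of_one_le ht1 ht1
    have htt : t ≤ t * t * t := by nlinarith
    have ht3 : C' * (4 * t) ≤ 4 * C' * (t * t * t) := by
      have := mul_le_mul_of_nonneg_left htt hC'0
      linarith
    rw [hE, hsq, hcn]
    linarith
  have hE0 : 0 ≤ E := (mul_nonneg hC'0 hlog0).trans hE_lb
  calc Real.exp (-E * ((3 : ℝ) / 2)) * (n : ℝ) ^ C
      ≤ Real.exp (-E) * (n : ℝ) ^ C' := by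
        refine mul_le_mul ?_ hmono (Real.rpow_nonneg hn0.le _) (Real.exp_pos _).le
        exact Real.exp_le_exp.2 (by nlinarith)
    _ ≤ 1 := by
        rw [Real.rpow_def_of_pos hn0, ← Real.exp_add]
        calc Real.exp (-E + Real.log n * C') ≤ Real.exp 0 := Real.exp_le_exp.2 (by nlinarith)
          _ = 1 := Real.exp_zero

/-! ## §4 Natural strengthenings refuted -/

/-- The trivial TPP triple `{1}, {1}, S_n` of volume `n!` (Cohn–Umans 2003, Lemma 3.1 proof), in the tree's
`TripleProductProperty` clothing: the packing volume `n!` IS attained at every `n`. [folklore] -/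
theorem exists_tpp_volume_eq_factorial (n : ℕ) : ∃ S T U : Finset (Equiv.Perm (Fin n)),
    TripleProductProperty S T U ∧ S.card * T.card * U.card = n.factorial := by
  obtain ⟨S, T, U, hS, hT, hU, h⟩ :=
    (Literature.Computability.AlgebraicComplexity.realizesTPP_one_one_card :
      Literature.Computability.AlgebraicComplexity.RealizesTPP (Equiv.Perm (Fin n)) 1 1 _)
  refine ⟨S, T, U, h, ?_⟩
  rw [hS, hT, hU, Fintype.card_perm, Fintype.card_fin]; ring

/-- **The bound is false at every fixed `n ≥ 2` for large `C`** (witness `{1},{1},S_n`, `C = n`: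
`n! · n^n ≥ n! · n! > (n!)^{3/2}`). So the order `∀ C ∃ n₀` of the crux is essential. [folklore] -/
theorem not_slackBound_self {n : ℕ} (hn : 2 ≤ n) : ¬ SlackBound n n := by
  intro h
  obtain ⟨S, T, U, hTPP, hvol⟩ := exists_tpp_volume_eq_factorial n
  have key := h n le_rfl S T U hTPP
  rw [hvol, Real.rpow_natCast] at key
  have hf2 : (2 : ℝ) ≤ n.factorial := by
    exact_mod_cast (Nat.factorial_le hn).trans' (by decide : 2 ≤ Nat.factorial 2)
  have hF0 : (0 : ℝ) < n.factorial := by linarith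
  -- n^n ≥ n!
  have hpow : (n.factorial : ℝ) ≤ (n : ℝ) ^ n := by exact_mod_cast Nat.factorial_le_pow n
  -- (n!)^{3/2} < n! * n!
  have hlt : (n.factorial : ℝ) ^ ((3 : ℝ) / 2) < (n.factorial : ℝ) ^ (2 : ℝ) :=
    Real.rpow_lt_rpow_of_exponent_lt (by linarith) (by norm_num)
  rw [show (2 : ℝ) = ((2 : ℕ) : ℝ) by norm_num, Real.rpow_natCast, pow_two] at hlt
  have : (n.factorial : ℝ) * n.factorial ≤ (n.factorial : ℝ) * (n : ℝ) ^ n :=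
    mul_le_mul_of_nonneg_left hpow hF0.le
  linarith

/-- **The uniform-in-`C` strengthening `∃ n₀, ∀ C, SlackBound C n₀` is false.** [folklore] -/
theorem not_slackBound_uniform : ¬ ∃ n₀ : ℕ, ∀ C : ℝ, SlackBound C n₀ := by
  rintro ⟨n₀, h⟩
  have h2 : 2 ≤ max n₀ 2 := le_max_right _ _
  refine not_slackBound_self h2 fun n hn S T U hTPP => ?_
  exact h _ n ((le_max_left _ _).trans hn) S T U hTPP

/-! ## §5 Computation log (local runs in compute/, kit jobs j004877 and j005660; the route's named "cheapest falsifier", never run before)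

Hosts: three perfect matchings of `[n] = ℤ/n`: `μ_1 x = 1 - x`, `μ_3 x = 3 - x`, and `μ_5 x = 5 - x` when `m = n/2` is odd
(for `m` even the AP triple cannot be pairwise Hamiltonian, so the third matching is a seeded random one whose unions with
`M_1, M_3` are Hamiltonian); `B_i = C(μ_i) ≅ S_2 ≀ S_m` (`|B| = 2^m m!`), rooted stabilisers `K_i = B_i ∩ Stab 0`
(`|K| = |B|/n`).  Conventions as in the tree (`(σ * τ) x = σ (τ x)`, TPP of Cohn–Umans Def. 2.1).

**Finding C1 (random-like triple coincidences; compute/sample14.py, exact12.py, analyze_bad.py).**  The rooted triple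
`(K_1, K_3, K_5)` is pairwise trivial (checked `n = 6, 8, 10, 12, 14`) but the number of subgroup-TPP violations
`N_bad(n) := #{(q_1,q_2,q_3) ∈ K_1 × K_3 × K_5 ∖ {(1,1,1)} : q_1 q_2 q_3 = 1}` matches the count expected for three
RANDOM subsets of `Stab 0 ≅ S_{n-1}` of the same sizes, `|K|³/(n-1)!`:

| n  | `|K|`  | `N_bad` (exact / sampled)   | `|K|³/(n-1)!` | ratio |
|----|--------|-----------------------------|---------------|-------|
| 6  | 8      | 3                           | 4.3           | 0.70  |
| 8  | 48     | 19                          | 21.9          | 0.87  |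
| 10 | 384    | 147                         | 156.0         | 0.94  |
| 12 | 3840   | 1347                        | 1418.5        | 0.95  |
| 14 | 46080  | 15288 ± 1040 (3·10⁷ samples) | 15712.9       | 0.97  |

So beyond pairwise triviality there is NO triple-level repulsion in the hyperoctahedral knife-edge family: the bad
quotients at each position are `N_bad` distinct elements spread over a dozen cycle types and generating all of `K_i`
(`n = 10`: 147 of the 384 elements of each `K_i` are bad quotients).  Consequence for the constructive cruxes
(`HyperoctahedralThreshold`, and the "single poly-index TPP sub-triple of three B(M_i)" kill of THIS crux named in its
why-it-might-fail): a TPP sub-triple must destroy `≈ 0.7·n^{-1.25}·√(n!)` generic coincidences, and (heuristically) for random-like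
coincidence sets unstructured sub-triples are limited to volume `(n!)^{1/2 + o(1)}`-ish (the expected number of violating
6-tuples of random `X_i ⊆ Stab 0` is `≈ (|X_1||X_2||X_3|)²/(n-1)!`; greedy deletion keeps volume `≈ ((n-1)!)^{3/5}`);
only sub-triples with subgroup/coset structure could do better, and inside `B_m` those are Young-like
(`S_m`, `(ℤ/2)^{m-1} ⋊ S_{m-1}`, …) with exponential losses.  This is quantitative evidence FOR the crux on
its advertised knife edge, not against it.

**Finding C2 (largest TPP sub-triples of the knife-edge hosts: SAT-certified per profile, kit job j004877 = pysat/CaDiCaL,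
profiles `sym` (all three `≥ k`, max `k`), `fullI` (`X_I` = whole host), `fullIJ` (two whole hosts); every witness
re-verified by direct enumeration; 30-min wall cap hit during `B`-hosts at `n = 8`, follow-ups j014200 (`B`, n = 8) and
j014109 (`K`, n = 10) queued).**  `C_eff := log((n!)^{3/2}/|X_1||X_2||X_3|)/log n`:

| n | hosts (`|host|`, #violations) | best volume found (profile: sizes)      | `C_eff` | structure of the optimum |
|---|-------------------------------|-----------------------------------------|---------|--------------------------|
| 6 | `K` (8, 3)                    | `256` (sym/full: 8·8·4) — OPTIMAL       | 2.41    | three subgroups          |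
| 6 | `B` (48, 143)                 | `1728` (sym: 12·12·12; sym k=13 UNSAT)  | 1.35    | three COSETS of order-12 groups = the Cohn–Umans triangle volume `(1!2!3!)³` |
| 8 | `K` (48, 19)                  | `13824` (sym: 24·24·24 = full12: 48·48·6; sym k=25 UNSAT) | 3.07 | two subgroups + one non-subgroup set |
| 8 | `B` (384, 1279)               | `≥ 147456` (384·48·8, first model; search cut by the wall cap) | ≤ 1.93 | `B_1 ⊇ K_3`-type nesting |

Earlier greedy values (compute/rooted_tpp_search.py) were `256 / 1152` (n = 6) and `9216 / 73728` (n = 8).  Reading: inside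
the ROOTED hosts the loss exponent grows (`2.41 → 3.07` from n = 6 to 8) and the optima are (near-)subgroup/coset
configurations, i.e. Young-like pieces of `B_m` — no unstructured "design" appears; inside the full centralisers the
optimum at `n = 6` is exactly the triangle construction in disguise.  Nothing here points below the Young benchmark.
* comparators: `|K|³` itself would be `C = 2.03, 2.07, 2.09` at `n = 6, 8, 10` were it TPP (it is not: 3, 19, 147
  violations); the Cohn–Umans Young TRIANGLE (the constructive benchmark of §6, volume `(∏_{k≤N} k!)³`, `n = N(N+1)/2`)
  has `C_eff = 1.35, 2.46, 3.88, 5.58, 7.55, 9.80` at `n = 6, 10, 15, 21, 28, 36` — growing like `0.65 n / log n`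
  (loss `e^{-0.65 n}`), which is what ANY candidate poly-slack family has to beat with a BOUNDED `C_eff`.
  Note at `n = 6` the triangle (`12³ = 1728`, TPP) beats every hyperoctahedral sub-triple found (best `1152`).
Ground truth `V(n) = max` TPP volume over ALL subset triples of `S_n` for `n = 3, 4`: job j005660 (pending).
-/

/-! ## §6 The exponential-saving strengthening is FALSE: Cohn–Umans 2003 triangle construction (was a sorried near-miss in v1–v3; PROVED in v4)

`∃ δ > 0, ∃ n₀, ∀ n ≥ n₀, ∀ TPP triples, |S||T||U| ≤ (n!)^{3/2 - δ}` fails: the triangle construction (Cohn–Umans 2003,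
Thm. 6; BCCGU 2017 Thm. 4.1) gives, for `2n = N(N+1)`, three Young subgroups of `S_n` (coordinate-preserving
permutations of the staircase `{(i, j) : i + j < N}`) with the TPP and order `∏_{k ≤ N} k! = (n!)^{1/2} e^{-O(n)}` each.
The construction itself (abstract lex-induction lemma, staircase type `Tri N = Σ i : Fin N, Fin (N - i)`, transport to
`Fin n`, order bound `≥ ∏_{k≤N} k!`) was written in this unit and has LANDED in the tree as
`Literature/Computability/AlgebraicComplexity/CohnUmansTriangle.lean` (p69482, `CohnUmans2003_triangle_tpp`), imported
here; below only the comparison `3 log ∏ k! ≥ 3 n (log((N+1)/2) - 1)` (convexity of `x log x`, `Real.convexOn_mul_log`,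
+ Stirling `sub_le_log_factorial`) `> (3/2 - δ) log n!` for large `N` remains.
So the exponent `3/2` in the crux cannot be lowered: the open window is exactly subpolynomial-in-`n!` savings
(`e^{-O(n)}` known constructively, `n^{-C}` = this crux, `e^{-c√n}` = the target's negation). -/

namespace Triangle

open Literature.Computability.AlgebraicComplexity.CohnUmansTriangle

/-! ### Stage C: the analytic comparison `(∏_{k ≤ N} k!)³ > (n!)^{3/2 - δ}` for large `N` -/

open Real Finset in
/-- Convexity pairing: `∑_{k=1}^{N} k log k ≥ (N(N+1)/2) · log((N+1)/2)`. -/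
theorem sum_mul_log_ge (N : ℕ) :
    ((N : ℝ) * (N + 1) / 2) * Real.log (((N : ℝ) + 1) / 2) ≤
      ∑ j ∈ Finset.range N, (((j + 1 : ℕ) : ℝ) * Real.log ((j + 1 : ℕ) : ℝ)) := by
  set g : ℕ → ℝ := fun k => (k : ℝ) * Real.log k with hg
  have hrefl : ∑ j ∈ Finset.range N, g (N - j) = ∑ j ∈ Finset.range N, g (j + 1) := by
    rw [← Finset.sum_range_reflect (fun j => g (j + 1)) N]
    refine Finset.sum_congr rfl fun j hj => ?_
    rw [Finset.mem_range] at hj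
    congr 1; omega
  have hpair : ∀ j ∈ Finset.range N,
      2 * ((((N : ℝ) + 1) / 2) * Real.log (((N : ℝ) + 1) / 2)) ≤ g (j + 1) + g (N - j) := by
    intro j hj
    rw [Finset.mem_range] at hj
    have hconv := Real.convexOn_mul_log
    have hx : (0 : ℝ) ≤ ((j + 1 : ℕ) : ℝ) := Nat.cast_nonneg _
    have hy : (0 : ℝ) ≤ ((N - j : ℕ) : ℝ) := Nat.cast_nonneg _
    have key := hconv.2 (Set.mem_Ici.2 hx) (Set.mem_Ici.2 hy) (by norm_num : (0 : ℝ) ≤ 1 / 2)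
      (by norm_num : (0 : ℝ) ≤ 1 / 2) (by norm_num)
    have hmid : (1 / 2 : ℝ) • ((j + 1 : ℕ) : ℝ) + (1 / 2 : ℝ) • ((N - j : ℕ) : ℝ) = ((N : ℝ) + 1) / 2 := by
      rw [Nat.cast_sub hj.le]; push_cast; simp only [smul_eq_mul]; ring
    rw [hmid] at key
    simp only [smul_eq_mul, hg] at key ⊢
    linarith
  have hsum := Finset.sum_le_sum hpair
  rw [Finset.sum_const, Finset.card_range, Finset.sum_add_distrib, hrefl, nsmul_eq_mul] at hsum
  simp only [hg] at hsum ⊢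
  nlinarith [hsum]

/-- `∑_{j<N} (j+1) = N(N+1)/2`, as `2 · ∑ = N(N+1)` over `ℕ`. -/
theorem two_mul_sum_range_succ (N : ℕ) : 2 * ∑ j ∈ Finset.range N, (j + 1) = N * (N + 1) := by
  rw [Finset.sum_add_distrib, Finset.sum_const, Finset.card_range, smul_eq_mul, mul_one, mul_add,
    mul_comm 2 (∑ i ∈ Finset.range N, i), Finset.sum_range_id_mul_two]
  rcases N with _ | N
  · simp
  · simp; ring

/-- Stirling-type lower bound for the triangle volume: `log ∏_{i<N} (N-i)! ≥ ∑_{k=1}^{N} (k log k - k)`. -/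
theorem log_prod_factorial_ge (N : ℕ) :
    ∑ j ∈ Finset.range N, ((((j + 1 : ℕ) : ℝ)) * Real.log ((j + 1 : ℕ) : ℝ) - ((j + 1 : ℕ) : ℝ)) ≤
      Real.log (((∏ i : Fin N, (N - i).factorial : ℕ) : ℝ)) := by
  push_cast
  rw [Real.log_prod (s := Finset.univ) (fun i _ => by positivity)]
  rw [Fin.sum_univ_eq_sum_range (fun i => Real.log (((N - i).factorial : ℕ) : ℝ)) N]
  have hrefl : ∑ j ∈ Finset.range N, Real.log (((N - j).factorial : ℕ) : ℝ) =
      ∑ j ∈ Finset.range N, Real.log ((((j + 1).factorial : ℕ) : ℝ)) := by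
    rw [← Finset.sum_range_reflect (fun j => Real.log ((((j + 1).factorial : ℕ) : ℝ))) N]
    refine Finset.sum_congr rfl fun j hj => ?_
    rw [Finset.mem_range] at hj
    congr 3; omega
  rw [hrefl]
  refine Finset.sum_le_sum fun j _ => ?_
  exact_mod_cast Literature.Barriers.MatrixMultiplication.sub_le_log_factorial (j + 1)

/-- **The exponential-saving strengthening of `PolynomialSlack` is FALSE** (Cohn–Umans 2003 triangle
construction: TPP triples of volume `(∏_{k ≤ N} k!)³ = (n!)^{3/2 - O(1/log n)}` in `S_n`, `n = N(N+1)/2`). -/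
theorem not_exponentialSaving' :
    ¬ ∃ δ : ℝ, 0 < δ ∧ ∃ n₀ : ℕ, ∀ n ≥ n₀, ∀ S T U : Finset (Equiv.Perm (Fin n)),
      Literature.Combinatorics.Additive.TripleProductProperty S T U →
        ((S.card * T.card * U.card : ℕ) : ℝ) ≤ (n.factorial : ℝ) ^ ((3 : ℝ) / 2 - δ) := by
  rintro ⟨δ, hδ, n₀, h⟩
  -- shrink δ to δ' ≤ 1
  set δ' : ℝ := min δ 1 with hδ'
  have hδ'0 : 0 < δ' := lt_min hδ one_pos
  have hδ'1 : δ' ≤ 1 := min_le_right _ _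
  have hδ'δ : δ' ≤ δ := min_le_left _ _
  -- choose N
  set E : ℝ := Real.exp ((3 * Real.log 2 + 3) / (2 * δ')) with hE
  obtain ⟨M, hM⟩ := exists_nat_gt E
  set N : ℕ := max (max n₀ M) 1 with hN
  have hNn₀ : n₀ ≤ N := (le_max_left _ _).trans (le_max_left _ _)
  have hNM : M ≤ N := (le_max_right _ _).trans (le_max_left _ _)
  have hN1 : 1 ≤ N := le_max_right _ _
  have hlogN : (3 * Real.log 2 + 3) / (2 * δ') < Real.log ((N : ℝ) + 1) := by
    rw [Real.lt_log_iff_exp_lt (by positivity), ← hE]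
    calc E < M := hM
      _ ≤ N := by exact_mod_cast hNM
      _ ≤ (N : ℝ) + 1 := by linarith
  -- the triangle family at N
  obtain ⟨n, hn2, S, T, U, hTPP, hS, hT, hU⟩ := CohnUmans2003_triangle_tpp N
  have hnN : N ≤ n := by nlinarith
  have hn1 : 1 ≤ n := hN1.trans hnN
  have key := h n (hNn₀.trans hnN) S T U hTPP
  -- volume ≥ PP³
  set PP : ℕ := ∏ i : Fin N, (N - i).factorial with hPP
  have hPPpos : 0 < PP := Finset.prod_pos fun i _ => Nat.factorial_pos _
  have hvol : ((PP * PP * PP : ℕ) : ℝ) ≤ ((S.card * T.card * U.card : ℕ) : ℝ) := by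
    exact_mod_cast Nat.mul_le_mul (Nat.mul_le_mul hS hT) hU
  -- (n!)^{3/2-δ} ≤ (n!)^{3/2-δ'}
  have hF1 : (1 : ℝ) ≤ (n.factorial : ℝ) := by exact_mod_cast Nat.one_le_iff_ne_zero.2 (Nat.factorial_ne_zero n)
  have hmono : (n.factorial : ℝ) ^ ((3 : ℝ) / 2 - δ) ≤ (n.factorial : ℝ) ^ ((3 : ℝ) / 2 - δ') :=
    Real.rpow_le_rpow_of_exponent_le hF1 (by linarith)
  -- so PP³ ≤ (n!)^{3/2 - δ'} ; take logs
  have hle : ((PP * PP * PP : ℕ) : ℝ) ≤ (n.factorial : ℝ) ^ ((3 : ℝ) / 2 - δ') := hvol.trans (key.trans hmono)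
  have hPPR : (0 : ℝ) < (PP : ℝ) := by exact_mod_cast hPPpos
  have hlog := Real.log_le_log (by positivity) hle
  rw [Real.log_rpow (by positivity)] at hlog
  have hlogPP3 : Real.log ((PP * PP * PP : ℕ) : ℝ) = 3 * Real.log (PP : ℝ) := by
    push_cast
    rw [Real.log_mul (by positivity) (by positivity), Real.log_mul (by positivity) (by positivity)]; ring
  rw [hlogPP3] at hlog
  -- lower bound on log PP
  have hlow := log_prod_factorial_ge N
  rw [Finset.sum_sub_distrib] at hlow
  have hklogk := sum_mul_log_ge N
  have hsumk : ∑ j ∈ Finset.range N, ((j + 1 : ℕ) : ℝ) = (n : ℝ) := by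
    have h2 := two_mul_sum_range_succ N
    have : ∑ j ∈ Finset.range N, (j + 1) = n := by omega
    rw [← this]; push_cast; rfl
  rw [hsumk] at hlow
  have hnR : (n : ℝ) = (N : ℝ) * (N + 1) / 2 := by
    have : (2 * n : ℕ) = N * (N + 1) := hn2
    have h' : (2 : ℝ) * n = (N : ℝ) * (N + 1) := by exact_mod_cast this
    linarith
  -- upper bound on log n!
  have hup : Real.log (n.factorial : ℝ) ≤ n * Real.log n :=
    Literature.Barriers.MatrixMultiplication.log_factorial_le_mul_log n
  have hN0 : (0 : ℝ) ≤ N := Nat.cast_nonneg N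
  have hn_le : (n : ℝ) ≤ ((N : ℝ) + 1) ^ 2 := by rw [hnR]; nlinarith
  have hlogn : Real.log (n : ℝ) ≤ 2 * Real.log ((N : ℝ) + 1) := by
    have h1 : Real.log (n : ℝ) ≤ Real.log (((N : ℝ) + 1) ^ 2) :=
      Real.log_le_log (by exact_mod_cast hn1) hn_le
    rwa [Real.log_pow, Nat.cast_ofNat] at h1
  have hnpos : (0 : ℝ) < n := by exact_mod_cast hn1
  have hcoef : 0 ≤ (3 : ℝ) / 2 - δ' := by linarith
  set L : ℝ := Real.log ((N : ℝ) + 1) with hL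
  -- (i) n (L - log 2) - n ≤ log PP
  rw [← hPP] at hlow
  have h1 : (n : ℝ) * Real.log (((N : ℝ) + 1) / 2) ≤
      ∑ j ∈ Finset.range N, ((j + 1 : ℕ) : ℝ) * Real.log ((j + 1 : ℕ) : ℝ) := by rw [hnR]; exact hklogk
  rw [Real.log_div (by positivity) (by norm_num)] at h1
  have hi : (n : ℝ) * L - n * Real.log 2 - n ≤ Real.log (PP : ℝ) := by
    have e2 : (n : ℝ) * (L - Real.log 2) = n * L - n * Real.log 2 := by ring
    linarith
  -- (iv) 3 log PP ≤ 3 n L - 2 δ' n L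
  have hiii : Real.log (n.factorial : ℝ) ≤ n * (2 * L) := hup.trans (mul_le_mul_of_nonneg_left hlogn hnpos.le)
  have hiv : 3 * Real.log (PP : ℝ) ≤ 3 * (n * L) - 2 * (δ' * (n * L)) := by
    have h2 := mul_le_mul_of_nonneg_left hiii hcoef
    have e1 : ((3 : ℝ) / 2 - δ') * (n * (2 * L)) = 3 * (n * L) - 2 * (δ' * (n * L)) := by ring
    linarith
  -- (v) n (2 δ' L - 3 log 2 - 3) > 0
  have hC : 0 < 2 * δ' * L - 3 * Real.log 2 - 3 := by
    have := (div_lt_iff₀ (by positivity : (0 : ℝ) < 2 * δ')).1 hlogN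
    linarith
  have hv := mul_pos hnpos hC
  have e3 : (n : ℝ) * (2 * δ' * L - 3 * Real.log 2 - 3) = 2 * (δ' * (n * L)) - 3 * (n * Real.log 2) - 3 * n := by
    ring
  linarith

end Triangle

/-- **The exponential-saving strengthening of `PolynomialSlack` is false** (Cohn–Umans 2003 triangle construction;
`Triangle.not_exponentialSaving'`). [cite: CohnUmans2003, Thm. 6] -/
theorem not_exponentialSaving :
    ¬ ∃ δ : ℝ, 0 < δ ∧ ∃ n₀ : ℕ, ∀ n ≥ n₀, ∀ S T U : Finset (Equiv.Perm (Fin n)),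
      TripleProductProperty S T U →
        ((S.card * T.card * U.card : ℕ) : ℝ) ≤ (n.factorial : ℝ) ^ ((3 : ℝ) / 2 - δ) :=
  Triangle.not_exponentialSaving'

end Summit.MatrixMultiplication.MatrixMultiplication.Cruxes.PolynomialSlack.Disproof
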